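/- Copyright: the b2b-balaban cell (near-miss cell 7), T⁴-continuum fan-out, lineage t4-ne7b-formalise-leaf-04 (node U5c
COUNT member), on the row owner's INTERFACE REQUEST NE7b IR-42-1 (ruling R-OWNER-42-2).  Released under the licence of
the surrounding project. -/
import Summits.QuantumFields.BalabanUV.T4Continuum.Support.HistoryAssemblyPrice

/-!
# The H3 price transfer with the realised cost read in TOTAL (`lifeCost`) form (INTERFACE REQUEST NE7b IR-42-1)

Summits-side support leaf of the T⁴-continuum cell (rung (B)+1 on a FINITE torus only; NOT infinite volume, NOT the
mass gap, NOT the Clay statement; NOT a proof of the spine estimate NE7b, which is the cell's OWN estimate, NOT PRINTED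
and NOT PROVED).  [folklore] bookkeeping over `HistoryConstantsTH` (p208521) and `HistoryAssemblyPrice`; nothing
printed is asserted, no `def … : Prop` fact, no cite-tagged hypothesis, zero `sorry`.

WHY (owner t4-ne7b-p1 gen 42, R-OWNER-42-2 «M5's COST SIDE IN TOTAL (lifeCost) FORM», located design observation
O-M5-1).  The END's H3 binder reads the realised per-step cost STEPWISE below the model's (`κ G n ≤ costT sh C K R G n`
on the padded life), but every consumer in the tree uses that binder ONLY through `lifeCostT_mono h = Finset.sum_le_sum h`,
i.e. through its TOTAL `lifeCost (padW …) κ G ≤ lifeCost (padW …) (costT sh C K R) G`.  The stepwise form is not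
robustly supplied by the S-geometry (merger cascades book several unit boxes at a step where `costT` books one window
floor), the total form is (each merger's own extension floors and connector budget pay the transitional units wherever
placed — the owner's M5-1).  THIS FILE re-reads the transfer chain with the binder in TOTAL form — a DROP-IN WEAKER
hypothesis, statements otherwise token-identical to the stepwise originals, which are recovered as the
`Finset.sum_le_sum` instances (`example`s):

* §1 (namespace `…HistoryConstants`, next to the originals of `HistoryConstantsTH`):
  **`Dominates.rawShapeT_le_of_lifeCost`**, **`Dominates.pshapeTH_le_shapeTH_of_lifeCost`**,
  **`Dominates.le_prod_shapeTH_of_lifeCost`**; the slack variants **`pshapeTH_mul_exp_le_shapeTH_of_slack_of_lifeCost`**,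
  **`le_prod_shapeTH_of_slack_of_lifeCost`**.
* §2 (namespace `…HistoryAssemblyPrice`): **`hprice_of_printed_total`** and **`hprice_of_printed_slack_total`** =
  `hprice_of_printed(_slack)` with
  `hκ : ∀ K, K₀ ≤ K → ∀ τ ∈ badTerms mem jstar T K, ∀ q ∈ mem K τ, lifeCost (padW (dictWT sh (R K) C.n₁) 0) (κ K q) q.2
  ≤ lifeCost (padW (dictWT sh (R K) C.n₁) 0) (costT sh C K (R K)) q.2`.

HONEST.  A weaker binder SHAPE for OUR H3 price transfer; the reading of `κ` against print ((1.80)–(1.81) ∕ (1.86)–(1.88),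
B16 pp. 380–383) stays M2∕M5's residual READING, displayed by the consumer; nothing of [Bałaban 1983–89] asserted or
cited; by-name class of every `WALL-NE7b-P1.md` §2 binder UNCHANGED; NE7b NOT PRINTED ∕ NOT PROVED; spine 0∕9.  HONEST
DEPENDENCY (cell): continuum YM on T⁴ ⇐ BetaPertH ∧ nine spine estimates (0/9 proved); BetaPertH ⇐ (D1) ∧ (D4) ∧
CAP+tail; G-an2-4 gates asym, D1 and NE2/3/4.  This file changes none of it.  POLICY (ruling e34b3e0c (0)): typed on the
CRUX prover's INTERFACE REQUEST IR-42-1, the only admissible source of a new `T4Continuum/Support` leaf. -/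

open Finset
open Literature.MathematicalPhysics.QuantumFieldTheory.Balaban1983to89
open T4PersistenceDictionary T4PersistentHistoryCount T4BankedInduction T4PrintedShapeBanking T4PartnerMultiplicity
open T4TaggedShapeBanking
open Summit.QuantumFields.BalabanUV.T4Continuum.LateMergers

noncomputable section

/-! ## §1 The shape domination chain with the cost binder in TOTAL form -/

namespace Summit.QuantumFields.BalabanUV.T4Continuum.HistoryConstants

section Total

variable {ε : Type*} [DecidableEq ε] {C : T4PrintedShapeBanking.Consts} {O : PrintedO1s} (sh : ε → PEv)

/-- **RAW TAGGED SHAPE DOMINATION, TOTAL FORM**: print's credits through `sh` and a realised cost whose LIFE TOTAL is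
below the model's give a raw factor below the model's `e^{−credits (credit ∘ sh)}·e^{+lifeCost W (costT sh)}` — the
binder of `Dominates.rawShapeT_le` weakened from `∀ n ∈ life W G, κ G n ≤ costT sh C K R G n` to its sum. [folklore] -/
theorem Dominates.rawShapeT_le_of_lifeCost (hD : Dominates C O) {K : ℕ} {R : ℕ → ℕ} (g : ℕ → ℝ) {W : ε → ℕ}
    {κ : Gen ε → ℕ → ℝ} {G : Gen ε} (h : lifeCost W κ G ≤ lifeCost W (costT sh C K R) G) :
    Real.exp (-credits (pcredit O C g ∘ sh) G) * Real.exp (lifeCost W κ G) ≤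
      Real.exp (-credits (credit C g ∘ sh) G) * Real.exp (lifeCost W (costT sh C K R) G) :=
  mul_le_mul (Real.exp_le_exp.2 (neg_le_neg (hD.creditsT_le sh g G))) (Real.exp_le_exp.2 h)
    (Real.exp_pos _).le (Real.exp_pos _).le

/-- the stepwise original IS the `Finset.sum_le_sum` instance of the total form -/
example (hD : Dominates C O) {K : ℕ} {R : ℕ → ℕ} (g : ℕ → ℝ) {W : ε → ℕ} {κ : Gen ε → ℕ → ℝ} {G : Gen ε}
    (h : ∀ n ∈ life W G, κ G n ≤ costT sh C K R G n) :
    Real.exp (-credits (pcredit O C g ∘ sh) G) * Real.exp (lifeCost W κ G) ≤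
      Real.exp (-credits (credit C g ∘ sh) G) * Real.exp (lifeCost W (costT sh C K R) G) :=
  hD.rawShapeT_le_of_lifeCost sh g (lifeCostT_mono h)

/-- **PRINT-PRICED TH SHAPE ≤ THE TH EXIT'S SHAPE, TOTAL FORM** (binders of `Dominates.pshapeTH_le_shapeTH` verbatim,
`h` in `lifeCost` form on the padded table). [folklore] -/
theorem Dominates.pshapeTH_le_shapeTH_of_lifeCost (hD : Dominates C O) {Δ Λ' : ℝ} (hΔ : 0 ≤ Δ) (hΛ : 0 ≤ Λ')
    (R : ℕ → ℕ) (g : ℕ → ℝ) (K D : ℕ) {κ : Gen ε → ℕ → ℝ} {G : Gen ε}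
    (h : lifeCost (padW (dictWT sh R C.n₁) D) κ G ≤ lifeCost (padW (dictWT sh R C.n₁) D) (costT sh C K R) G) :
    pshapeTH sh O C Δ Λ' R g D κ G ≤ shapeTH sh C Δ Λ' R g K D G := by
  unfold pshapeTH shapeTH
  exact mul_le_mul_of_nonneg_left
    (mul_le_mul_of_nonneg_left (hD.rawShapeT_le_of_lifeCost sh g h) (pow_nonneg hΛ _)) hΔ

/-- **THE PRODUCT STEP, TOTAL FORM** (binders of `Dominates.le_prod_shapeTH` verbatim, `h` in `lifeCost` form per
member). [folklore] -/
theorem Dominates.le_prod_shapeTH_of_lifeCost (hD : Dominates C O) {Δ Λ' : ℝ} (hΔ : 0 ≤ Δ) (hΛ : 0 ≤ Λ')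
    (R : ℕ → ℕ) (g : ℕ → ℝ) (K D : ℕ) {ι : Type*} (S : Finset ι) (gen : ι → Gen ε) {mult : ι → ℝ}
    (hmult : ∀ q ∈ S, 0 ≤ mult q) (κ : ι → Gen ε → ℕ → ℝ)
    (h : ∀ q ∈ S, lifeCost (padW (dictWT sh R C.n₁) D) (κ q) (gen q) ≤
      lifeCost (padW (dictWT sh R C.n₁) D) (costT sh C K R) (gen q))
    {x : ℝ} (hx : x ≤ ∏ q ∈ S, mult q * pshapeTH sh O C Δ Λ' R g D (κ q) (gen q)) :
    x ≤ ∏ q ∈ S, mult q * shapeTH sh C Δ Λ' R g K D (gen q) :=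
  hx.trans (prod_le_prod (fun q hq => mul_nonneg (hmult q hq) (pshapeTH_nonneg sh hΔ hΛ R g D _ _))
    fun q hq => mul_le_mul_of_nonneg_left (hD.pshapeTH_le_shapeTH_of_lifeCost sh hΔ hΛ R g K D (h q hq))
      (hmult q hq))

/-- the stepwise `Dominates.le_prod_shapeTH` IS the `Finset.sum_le_sum` instance of the total form -/
example (hD : Dominates C O) {Δ Λ' : ℝ} (hΔ : 0 ≤ Δ) (hΛ : 0 ≤ Λ') (R : ℕ → ℕ) (g : ℕ → ℝ) (K D : ℕ)
    {ι : Type*} (S : Finset ι) (gen : ι → Gen ε) {mult : ι → ℝ} (hmult : ∀ q ∈ S, 0 ≤ mult q)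
    (κ : ι → Gen ε → ℕ → ℝ)
    (h : ∀ q ∈ S, ∀ n ∈ life (padW (dictWT sh R C.n₁) D) (gen q), κ q (gen q) n ≤ costT sh C K R (gen q) n)
    {x : ℝ} (hx : x ≤ ∏ q ∈ S, mult q * pshapeTH sh O C Δ Λ' R g D (κ q) (gen q)) :
    x ≤ ∏ q ∈ S, mult q * shapeTH sh C Δ Λ' R g K D (gen q) :=
  hD.le_prod_shapeTH_of_lifeCost sh hΔ hΛ R g K D S gen hmult κ (fun q hq => lifeCostT_mono (h q hq)) hx

/-- **PRINT-PRICED TH SHAPE × CLASS-LINEAR FACTOR ≤ THE TH EXIT'S SHAPE, TOTAL FORM** (binders of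
`pshapeTH_mul_exp_le_shapeTH_of_slack` verbatim, `h` in `lifeCost` form). [folklore] -/
theorem pshapeTH_mul_exp_le_shapeTH_of_slack_of_lifeCost {θ : ℝ} (hθ : 0 ≤ θ)
    (hslack : C.a + θ ≤ O.γ₀ * O.A₁ ^ 2 / 2) {Δ Λ' : ℝ} (hΔ : 0 ≤ Δ) (hΛ : 0 ≤ Λ') (R : ℕ → ℕ) (g : ℕ → ℝ)
    (K D : ℕ) {κ : Gen ε → ℕ → ℝ} {G : Gen ε}
    (hP : ∀ e ∈ G.events, (sh e).kind = 0 → 1 ≤ p0Profile C.A₀ C.p₀ (g (sh e).step))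
    (h : lifeCost (padW (dictWT sh R C.n₁) D) κ G ≤ lifeCost (padW (dictWT sh R C.n₁) D) (costT sh C K R) G) :
    pshapeTH sh O C Δ Λ' R g D κ G * Real.exp (θ * birthLinT sh G) ≤ shapeTH sh C Δ Λ' R g K D G := by
  unfold pshapeTH shapeTH
  have hc : Real.exp (-credits (pcredit O C g ∘ sh) G) * Real.exp (θ * birthLinT sh G) ≤
      Real.exp (-credits (credit C g ∘ sh) G) := by
    rw [← Real.exp_add]
    exact Real.exp_le_exp.2 (by linarith [creditsT_slack sh hθ hslack g hP])
  have hl : Real.exp (lifeCost (padW (dictWT sh R C.n₁) D) κ G) ≤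
      Real.exp (lifeCost (padW (dictWT sh R C.n₁) D) (costT sh C K R) G) :=
    Real.exp_le_exp.2 h
  have hraw : Real.exp (-credits (pcredit O C g ∘ sh) G) * Real.exp (lifeCost (padW (dictWT sh R C.n₁) D) κ G) *
      Real.exp (θ * birthLinT sh G) ≤ Real.exp (-credits (credit C g ∘ sh) G) *
        Real.exp (lifeCost (padW (dictWT sh R C.n₁) D) (costT sh C K R) G) := by
    calc _ = Real.exp (-credits (pcredit O C g ∘ sh) G) * Real.exp (θ * birthLinT sh G) *
          Real.exp (lifeCost (padW (dictWT sh R C.n₁) D) κ G) := by ring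
      _ ≤ _ := mul_le_mul hc hl (Real.exp_pos _).le (Real.exp_pos _).le
  have hpre : 0 ≤ Δ * Λ' ^ partnerAges (PEv.step ∘ sh) G := mul_nonneg hΔ (pow_nonneg hΛ _)
  calc _ = Δ * Λ' ^ partnerAges (PEv.step ∘ sh) G * (Real.exp (-credits (pcredit O C g ∘ sh) G) *
        Real.exp (lifeCost (padW (dictWT sh R C.n₁) D) κ G) * Real.exp (θ * birthLinT sh G)) := by ring
    _ ≤ Δ * Λ' ^ partnerAges (PEv.step ∘ sh) G * (Real.exp (-credits (credit C g ∘ sh) G) *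
        Real.exp (lifeCost (padW (dictWT sh R C.n₁) D) (costT sh C K R) G)) :=
      mul_le_mul_of_nonneg_left hraw hpre
    _ = _ := by ring

/-- **THE PRODUCT STEP, SLACK VARIANT, TOTAL FORM** (binders of `le_prod_shapeTH_of_slack` verbatim, `h` in `lifeCost`
form per member). [folklore] -/
theorem le_prod_shapeTH_of_slack_of_lifeCost {θ : ℝ} (hθ : 0 ≤ θ)
    (hslack : C.a + θ ≤ O.γ₀ * O.A₁ ^ 2 / 2) {Δ Λ' : ℝ} (hΔ : 0 ≤ Δ) (hΛ : 0 ≤ Λ') (R : ℕ → ℕ) (g : ℕ → ℝ)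
    (K D : ℕ) {ι : Type*} (S : Finset ι) (gen : ι → Gen ε) {mult : ι → ℝ} (hmult : ∀ q ∈ S, 0 ≤ mult q)
    (κ : ι → Gen ε → ℕ → ℝ)
    (hP : ∀ q ∈ S, ∀ e ∈ (gen q).events, (sh e).kind = 0 → 1 ≤ p0Profile C.A₀ C.p₀ (g (sh e).step))
    (h : ∀ q ∈ S, lifeCost (padW (dictWT sh R C.n₁) D) (κ q) (gen q) ≤
      lifeCost (padW (dictWT sh R C.n₁) D) (costT sh C K R) (gen q))
    {x : ℝ} (hx : x ≤ ∏ q ∈ S, mult q * (pshapeTH sh O C Δ Λ' R g D (κ q) (gen q) *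
      Real.exp (θ * birthLinT sh (gen q)))) :
    x ≤ ∏ q ∈ S, mult q * shapeTH sh C Δ Λ' R g K D (gen q) :=
  hx.trans (prod_le_prod
    (fun q hq => mul_nonneg (hmult q hq) (mul_nonneg (pshapeTH_nonneg sh hΔ hΛ R g D _ _) (Real.exp_pos _).le))
    fun q hq => mul_le_mul_of_nonneg_left
      (pshapeTH_mul_exp_le_shapeTH_of_slack_of_lifeCost sh hθ hslack hΔ hΛ R g K D (hP q hq) (h q hq)) (hmult q hq))

/-- the stepwise `le_prod_shapeTH_of_slack` IS the `Finset.sum_le_sum` instance of the total form -/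
example {θ : ℝ} (hθ : 0 ≤ θ) (hslack : C.a + θ ≤ O.γ₀ * O.A₁ ^ 2 / 2) {Δ Λ' : ℝ} (hΔ : 0 ≤ Δ) (hΛ : 0 ≤ Λ')
    (R : ℕ → ℕ) (g : ℕ → ℝ) (K D : ℕ) {ι : Type*} (S : Finset ι) (gen : ι → Gen ε) {mult : ι → ℝ}
    (hmult : ∀ q ∈ S, 0 ≤ mult q) (κ : ι → Gen ε → ℕ → ℝ)
    (hP : ∀ q ∈ S, ∀ e ∈ (gen q).events, (sh e).kind = 0 → 1 ≤ p0Profile C.A₀ C.p₀ (g (sh e).step))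
    (h : ∀ q ∈ S, ∀ n ∈ life (padW (dictWT sh R C.n₁) D) (gen q), κ q (gen q) n ≤ costT sh C K R (gen q) n)
    {x : ℝ} (hx : x ≤ ∏ q ∈ S, mult q * (pshapeTH sh O C Δ Λ' R g D (κ q) (gen q) *
      Real.exp (θ * birthLinT sh (gen q)))) :
    x ≤ ∏ q ∈ S, mult q * shapeTH sh C Δ Λ' R g K D (gen q) :=
  le_prod_shapeTH_of_slack_of_lifeCost sh hθ hslack hΔ hΛ R g K D S gen hmult κ hP
    (fun q hq => lifeCostT_mono (h q hq)) hx

end Total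

end Summit.QuantumFields.BalabanUV.T4Continuum.HistoryConstants

/-! ## §2 Printed-currency price readings give the model-currency reading — cost binder in TOTAL form -/

namespace Summit.QuantumFields.BalabanUV.T4Continuum.HistoryAssemblyPrice

open T4BranchingRecordsGas
open Summit.QuantumFields.BalabanUV.T4Continuum.HistoryConstants
open Summit.QuantumFields.BalabanUV.T4Continuum.HistoryGen
open Summit.QuantumFields.BalabanUV.T4Continuum.HistoryAssemblyTerms

section PrintedTotal

variable {ε γ ι : Type*} [DecidableEq ε] [DecidableEq γ] {C : T4PrintedShapeBanking.Consts} {O : PrintedO1s}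

/-- **PRINTED PRICES GIVE THE MODEL-CURRENCY READING, COST BINDER IN TOTAL FORM** (INTERFACE REQUEST IR-42-1): as
`hprice_of_printed`, with the realised cost of every member read below the model's in `lifeCost` (total) form on the
member's padded life — `Dominates.le_prod_shapeTH_of_lifeCost`. [folklore] -/
theorem hprice_of_printed_total (sh : ε → PEv) (hD : Dominates C O) {Λ' : ℝ} (hΛ : 0 ≤ Λ') (R : ℕ → ℕ → ℕ)
    (g : ℕ → ℕ → ℝ) {l₀ : ℝ} {K₀ : ℕ} {T : ℕ → Finset ι} {mem : ℕ → ι → Finset (γ × Gen ε)} {jstar : ℕ → ℕ}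
    {Fc Rf : ℕ → Finset (BSlot γ PEv) → ℝ} (κ : ℕ → γ × Gen ε → Gen ε → ℕ → ℝ)
    (hκ : ∀ K, K₀ ≤ K → ∀ τ ∈ badTerms mem jstar T K, ∀ q ∈ mem K τ,
      lifeCost (padW (dictWT sh (R K) C.n₁) 0) (κ K q) q.2 ≤
        lifeCost (padW (dictWT sh (R K) C.n₁) 0) (costT sh C K (R K)) q.2)
    (hP : ∀ K t, |t| ≤ l₀ → K₀ ≤ K → ∀ τ ∈ badTerms mem jstar T K,
      Fc K (HistorySocketTH.bstrOf sh mem K τ) * Rf K (HistorySocketTH.bstrOf sh mem K τ) ≤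
        ∏ q ∈ mem K τ, pshapeTH sh O C 1 Λ' (R K) (g K) 0 (κ K q) q.2) :
    ∀ K t, |t| ≤ l₀ → K₀ ≤ K → ∀ τ ∈ badTerms mem jstar T K,
      Fc K (HistorySocketTH.bstrOf sh mem K τ) * Rf K (HistorySocketTH.bstrOf sh mem K τ) ≤
        ∏ q ∈ mem K τ, priceT sh C Λ' R g K q := by
  intro K t ht hK τ hτ
  have hx : Fc K (HistorySocketTH.bstrOf sh mem K τ) * Rf K (HistorySocketTH.bstrOf sh mem K τ) ≤
      ∏ q ∈ mem K τ, 1 * pshapeTH sh O C 1 Λ' (R K) (g K) 0 (κ K q) q.2 := by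
    simpa only [one_mul] using hP K t ht hK τ hτ
  have h := hD.le_prod_shapeTH_of_lifeCost sh zero_le_one hΛ (R K) (g K) K 0 (mem K τ) (fun q => q.2)
    (mult := fun _ => 1) (fun _ _ => zero_le_one) (fun q => κ K q) (hκ K hK τ hτ) hx
  simpa only [one_mul, priceT_eq_cshapeTH] using h

/-- the stepwise `hprice_of_printed` IS the `Finset.sum_le_sum` instance of the total form -/
example (sh : ε → PEv) (hD : Dominates C O) {Λ' : ℝ} (hΛ : 0 ≤ Λ') (R : ℕ → ℕ → ℕ)
    (g : ℕ → ℕ → ℝ) {l₀ : ℝ} {K₀ : ℕ} {T : ℕ → Finset ι} {mem : ℕ → ι → Finset (γ × Gen ε)} {jstar : ℕ → ℕ}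
    {Fc Rf : ℕ → Finset (BSlot γ PEv) → ℝ} (κ : ℕ → γ × Gen ε → Gen ε → ℕ → ℝ)
    (hκ : ∀ K, K₀ ≤ K → ∀ τ ∈ badTerms mem jstar T K, ∀ q ∈ mem K τ,
      ∀ n ∈ life (padW (dictWT sh (R K) C.n₁) 0) q.2, κ K q q.2 n ≤ costT sh C K (R K) q.2 n)
    (hP : ∀ K t, |t| ≤ l₀ → K₀ ≤ K → ∀ τ ∈ badTerms mem jstar T K,
      Fc K (HistorySocketTH.bstrOf sh mem K τ) * Rf K (HistorySocketTH.bstrOf sh mem K τ) ≤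
        ∏ q ∈ mem K τ, pshapeTH sh O C 1 Λ' (R K) (g K) 0 (κ K q) q.2) :
    ∀ K t, |t| ≤ l₀ → K₀ ≤ K → ∀ τ ∈ badTerms mem jstar T K,
      Fc K (HistorySocketTH.bstrOf sh mem K τ) * Rf K (HistorySocketTH.bstrOf sh mem K τ) ≤
        ∏ q ∈ mem K τ, priceT sh C Λ' R g K q :=
  hprice_of_printed_total sh hD hΛ R g κ (fun K hK τ hτ q hq => lifeCostT_mono (hκ K hK τ hτ q hq)) hP

/-- **… WITH THE CLASS-LINEAR SLACK, COST BINDER IN TOTAL FORM**: as `hprice_of_printed_slack`, `hκ` in `lifeCost` form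
— `le_prod_shapeTH_of_slack_of_lifeCost`. [folklore] -/
theorem hprice_of_printed_slack_total (sh : ε → PEv) {θ : ℝ} (hθ : 0 ≤ θ)
    (hslack : C.a + θ ≤ O.γ₀ * O.A₁ ^ 2 / 2) {Λ' : ℝ} (hΛ : 0 ≤ Λ') (R : ℕ → ℕ → ℕ) (g : ℕ → ℕ → ℝ) {l₀ : ℝ}
    {K₀ : ℕ} {T : ℕ → Finset ι} {mem : ℕ → ι → Finset (γ × Gen ε)} {jstar : ℕ → ℕ}
    {Fc Rf : ℕ → Finset (BSlot γ PEv) → ℝ}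
    (hP1 : ∀ K, K₀ ≤ K → ∀ τ ∈ badTerms mem jstar T K, ∀ q ∈ mem K τ,
      ∀ e ∈ q.2.events, (sh e).kind = 0 → 1 ≤ p0Profile C.A₀ C.p₀ (g K (sh e).step))
    (κ : ℕ → γ × Gen ε → Gen ε → ℕ → ℝ)
    (hκ : ∀ K, K₀ ≤ K → ∀ τ ∈ badTerms mem jstar T K, ∀ q ∈ mem K τ,
      lifeCost (padW (dictWT sh (R K) C.n₁) 0) (κ K q) q.2 ≤
        lifeCost (padW (dictWT sh (R K) C.n₁) 0) (costT sh C K (R K)) q.2)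
    (hP : ∀ K t, |t| ≤ l₀ → K₀ ≤ K → ∀ τ ∈ badTerms mem jstar T K,
      Fc K (HistorySocketTH.bstrOf sh mem K τ) * Rf K (HistorySocketTH.bstrOf sh mem K τ) ≤
        ∏ q ∈ mem K τ, pshapeTH sh O C 1 Λ' (R K) (g K) 0 (κ K q) q.2 * Real.exp (θ * birthLinT sh q.2)) :
    ∀ K t, |t| ≤ l₀ → K₀ ≤ K → ∀ τ ∈ badTerms mem jstar T K,
      Fc K (HistorySocketTH.bstrOf sh mem K τ) * Rf K (HistorySocketTH.bstrOf sh mem K τ) ≤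
        ∏ q ∈ mem K τ, priceT sh C Λ' R g K q := by
  intro K t ht hK τ hτ
  have hx : Fc K (HistorySocketTH.bstrOf sh mem K τ) * Rf K (HistorySocketTH.bstrOf sh mem K τ) ≤
      ∏ q ∈ mem K τ, 1 * (pshapeTH sh O C 1 Λ' (R K) (g K) 0 (κ K q) q.2 * Real.exp (θ * birthLinT sh q.2)) := by
    simpa only [one_mul] using hP K t ht hK τ hτ
  have h := le_prod_shapeTH_of_slack_of_lifeCost sh hθ hslack zero_le_one hΛ (R K) (g K) K 0 (mem K τ)
    (fun q => q.2) (mult := fun _ => 1) (fun _ _ => zero_le_one) (fun q => κ K q) (hP1 K hK τ hτ) (hκ K hK τ hτ) hx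
  simpa only [one_mul, priceT_eq_cshapeTH] using h

end PrintedTotal

end Summit.QuantumFields.BalabanUV.T4Continuum.HistoryAssemblyPrice

end
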